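import Literature.MathematicalPhysics.QuantumLattice.MagneticHubbardTorusPeierls
import Literature.MathematicalPhysics.QuantumLattice.PairFieldMomentum
import Literature.MathematicalPhysics.QuantumLattice.PairCorrelationsProofs
import Literature.MathematicalPhysics.QuantumLattice.PseudospinBondPairTriplet
import HarnessLib

/-!
# Galilean (Bloch) boosts of the pair field on the Hubbard torus

Trunk T-QLATTICE, family `hubbard`. Literature REPRODUCTION (the folklore bookkeeping behind
Bloch's theorem on persistent currents and the Lieb–Schultz–Mattis / Watanabe twist), built on
`phaseGauge` (`MagneticHubbardTorus(Gauge)`), the Peierls identity (`MagneticHubbardTorusPeierls`),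
the momentum-resolved pair field `pairFieldAt` (`PairFieldMomentum`) and the singlet bond pair
`bondPairAnn` (`PseudospinBondPairTriplet`); no existing statement is changed.

**What is reproduced.** For `k ∈ ℤ/L` the Bloch / Lieb–Schultz–Mattis boost
`W_k = exp[2πi (k/L) Σ_x x₁ n_x]` (the "twist operator" `U_m` of H. Watanabe, J. Stat. Phys.
**177** (2019) 717, §2.2.1; D. Bohm, Phys. Rev. **75** (1949) 502) is the site-phase unitary
`pairBoost L k = phaseGauge (x ↦ e(k x₁))`, `e(j) = exp(2πi j/L)`. (i) `W_gᴴ c_{yσ} W_g = g_y c_{yσ}`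
(Koma–Tasaki, PRL **68** (1992) 3248, eqs. (7)–(8)) and `W_gᴴ d_{yz} W_g = g_y g_z d_{yz}` for
the bond pair `d_{yz} = c_{y↑}c_{z↓} - c_{y↓}c_{z↑}`. (ii) **The boosted Hamiltonian is the
uniformly twisted torus**, `W_sᴴ H W_s = H_A`, `A = uniformTwistConfig L (-2πs)` (a pure gauge),
whence `Re⟨W_s ψ, H W_s ψ⟩ = Re⟨ψ, H ψ⟩ + 2(1 - cos(2πs/L)) K(ψ) - 2 sin(2πs/L) J(ψ)` (Watanabe
(2019) §2.2.1, eqs. (13)–(16); Bohm (1949)). (iii) **A boost shifts the pair momentum by `2k`**: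
`W_kᴴ Δ_g W_k = Σ_x conj χ_{m_k}(x) • P_x^{(k)}`, `m_k = (-2k, 0)`, with the bond-twisted local
pair `P_x^{(k)} = Σ_e (g e/√2) e(k e₁) d_{x,x+e}`, and the deviation estimate
`‖(W_sᴴ Δ_g W_s - Δ_g(m_s)) ψ‖ ≤ 2π|s| L C_g ‖ψ‖` (`C_g = Σ_e 2|g e|/√2`) from the chord–arc
bound `|e(j) - 1| ≤ 2π|j|/L`. Used summit-side (soloist `solo-HubbardSuperconductivity-informed`,
paper §12) to bound the lowest eigenvalue of `Δ_d† Δ_d + τ(H - E₀)` on a sector from above.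

## Sources

H. Watanabe, J. Stat. Phys. **177** (2019) 717, §2.2.1, §2.2.3, §4.1 [cite: Watanabe2019];
D. Bohm, Phys. Rev. **75** (1949) 502 [cite: Bohm1949]; T. Koma, H. Tasaki, PRL **68** (1992)
3248, eqs. (5), (7)–(8) [cite: KomaTasakiPRL1992]; D. J. Scalapino, Phys. Rep. **250** (1995)
329, §2 [cite: Scalapino1995]; T. Kennedy, E. H. Lieb, B. S. Shastry, PRL **61** (1988) 2582
[cite: KLS1988PRL].
-/

noncomputable section

namespace Literature.MathematicalPhysics.QuantumLattice

open Matrix Finset Literature.Probability.LatticeModels HubbardWave0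
open Literature.MathematicalPhysics.QuantumFieldTheory (gaugeTransform)
open scoped ComplexConjugate ComplexOrder

/-! ### Conjugating by a site-phase unitary from the left -/

section PhaseGauge

variable {Λ : Type*} [LinearOrder Λ] [Fintype Λ]

/-- **`W_gᴴ c_{yσ} W_g = g_y c_{yσ}`** for the site-phase unitary `W_g = phaseGauge g` (Koma–Tasaki's
eq. (8) read from the other side, `W_gᴴ = W_{g⁻¹}`). [cite: KomaTasakiPRL1992, eqs. (7)–(8)] -/
theorem conjTranspose_phaseGauge_mul_annihilation_mul_phaseGauge (G : Λ → Circle) (y : Λ)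
    (σ : Fin 2) :
    (phaseGauge G)ᴴ * annihilation (orb y σ) * phaseGauge G =
      ((G y : Circle) : ℂ) • annihilation (orb y σ) := by
  have hW : (phaseGauge G⁻¹)ᴴ = phaseGauge G := by rw [phaseGauge_conjTranspose, inv_inv]
  calc (phaseGauge G)ᴴ * annihilation (orb y σ) * phaseGauge G
      = phaseGauge G⁻¹ * annihilation (orb y σ) * (phaseGauge G⁻¹)ᴴ := by
        rw [hW, phaseGauge_conjTranspose]
    _ = conj (((G⁻¹ y : Circle)) : ℂ) • annihilation (orb y σ) :=
        phaseGauge_mul_annihilation_mul_conjTranspose _ _ _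
    _ = ((G y : Circle) : ℂ) • annihilation (orb y σ) := by
        rw [Pi.inv_apply, Circle.coe_inv_eq_conj, Complex.conj_conj]

/-- Conjugation `X ↦ W_gᴴ X W_g` is multiplicative (`W_g W_gᴴ = 1`). [folklore] -/
theorem conjTranspose_phaseGauge_mul_mul_mul_phaseGauge (G : Λ → Circle)
    (X Y : Matrix (Finset (Orb Λ)) (Finset (Orb Λ)) ℂ) :
    (phaseGauge G)ᴴ * (X * Y) * phaseGauge G =
      (phaseGauge G)ᴴ * X * phaseGauge G * ((phaseGauge G)ᴴ * Y * phaseGauge G) := by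
  have h2 : ∀ Z : Matrix (Finset (Orb Λ)) (Finset (Orb Λ)) ℂ,
      phaseGauge G * ((phaseGauge G)ᴴ * Z) = Z := fun Z => by
    rw [← Matrix.mul_assoc, phaseGauge_mul_conjTranspose_self, Matrix.one_mul]
  simp only [Matrix.mul_assoc, h2]

/-- **`W_gᴴ d_{yz} W_g = g_y g_z d_{yz}`** for the singlet bond pair `d_{yz} = c_{y↑}c_{z↓} - c_{y↓}c_{z↑}`
(`bondPairAnn`): a pair carries charge two. Koma–Tasaki (1992) eq. (8). [folklore] -/
theorem conjTranspose_phaseGauge_mul_bondPairAnn_mul_phaseGauge (G : Λ → Circle) (y z : Λ) :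
    (phaseGauge G)ᴴ * bondPairAnn y z * phaseGauge G =
      (((G y : Circle) : ℂ) * ((G z : Circle) : ℂ)) • bondPairAnn y z := by
  simp only [bondPairAnn, Matrix.mul_sub, Matrix.sub_mul,
    conjTranspose_phaseGauge_mul_mul_mul_phaseGauge,
    conjTranspose_phaseGauge_mul_annihilation_mul_phaseGauge, Matrix.smul_mul, Matrix.mul_smul,
    smul_smul, smul_sub, mul_comm]

/-- `⟨W_g ψ, W_g ψ⟩ = ⟨ψ, ψ⟩`: site phases are unitary. [cite: KomaTasakiPRL1992, eq. (5)] -/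
theorem star_phaseGauge_mulVec_dotProduct (G : Λ → Circle) (ψ : Fock (Orb Λ)) :
    star (phaseGauge G *ᵥ ψ) ⬝ᵥ (phaseGauge G *ᵥ ψ) = star ψ ⬝ᵥ ψ := by
  rw [star_mulVec_dotProduct_mulVec, conjTranspose_phaseGauge_mul_self, Matrix.one_mulVec]

/-- Unitary invariance `‖(W_gᴴ X W_g) ψ‖² = ‖X (W_g ψ)‖²`, in `dotProduct` form. [folklore] -/
theorem star_conj_phaseGauge_mulVec_dotProduct (G : Λ → Circle)
    (X : Matrix (Finset (Orb Λ)) (Finset (Orb Λ)) ℂ) (ψ : Fock (Orb Λ)) :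
    star (((phaseGauge G)ᴴ * X * phaseGauge G) *ᵥ ψ) ⬝ᵥ (((phaseGauge G)ᴴ * X * phaseGauge G) *ᵥ ψ) =
      star (X *ᵥ (phaseGauge G *ᵥ ψ)) ⬝ᵥ (X *ᵥ (phaseGauge G *ᵥ ψ)) := by
  have h2 : ∀ Z : Matrix (Finset (Orb Λ)) (Finset (Orb Λ)) ℂ,
      phaseGauge G * ((phaseGauge G)ᴴ * Z) = Z := fun Z => by
    rw [← Matrix.mul_assoc, phaseGauge_mul_conjTranspose_self, Matrix.one_mul]
  rw [mulVec_mulVec, star_mulVec_dotProduct_mulVec, star_mulVec_dotProduct_mulVec]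
  congr 2
  simp only [conjTranspose_mul, conjTranspose_conjTranspose, Matrix.mul_assoc, h2]

/-- `‖d_{yz} ψ‖ ≤ 2 ‖ψ‖`: each product of two annihilation operators is a contraction.
Bratteli–Robinson II §5.2.2. [folklore] -/
theorem norm_toLp_bondPairAnn_mulVec_le (y z : Λ) (ψ : Fock (Orb Λ)) :
    ‖(WithLp.toLp 2 (bondPairAnn y z *ᵥ ψ) : EuclideanSpace ℂ (Finset (Orb Λ)))‖ ≤
      2 * ‖(WithLp.toLp 2 ψ : EuclideanSpace ℂ (Finset (Orb Λ)))‖ := by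
  rw [bondPairAnn, Matrix.sub_mulVec, ← Matrix.mulVec_mulVec, ← Matrix.mulVec_mulVec,
    WithLp.toLp_sub, two_mul]
  exact (norm_sub_le _ _).trans (add_le_add
    ((norm_toLp_annihilation_mulVec_le _ _).trans (norm_toLp_annihilation_mulVec_le _ _))
    ((norm_toLp_annihilation_mulVec_le _ _).trans (norm_toLp_annihilation_mulVec_le _ _)))

end PhaseGauge

/-! ### The boost on the torus `(ℤ/L)²` -/

section Defs

variable (g : Site 2 → ℝ) (L : ℕ) [NeZero L]

/-- The **boost phase** `x ↦ e(k x₁) = exp(2πi k x₁/L)` (`k ∈ ℤ/L`), a character of the first torus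
coordinate (Watanabe's `U_m` with total flux `2πk`). [cite: Watanabe2019, §2.2.1 (twist operator U_m)] -/
def pairBoostPhase (k : ZMod L) (x : TorusSite 2 L) : Circle :=
  ZMod.toCircle (k * x 0)

/-- The **boost unitary** `W_k = exp[2πi (k/L) Σ_x x₁ (n_{x↑} + n_{x↓})]` = `phaseGauge` of
`pairBoostPhase`. Watanabe (2019) §2.2.1; Bohm (1949). [cite: Watanabe2019, §2.2.1 (twist operator U_m)] -/
def pairBoost (k : ZMod L) :
    Matrix (Finset (Orb (FermionTorus 2 L))) (Finset (Orb (FermionTorus 2 L))) ℂ :=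
  phaseGauge fun u : FermionTorus 2 L => pairBoostPhase L k u.toTorusSite

/-- The momentum label `m_k = (-(2k), 0)` of the boosted pair field (sign convention of
`pairFieldAt`: `conj χ_{m_k}(x) = e(2k x₁)`). [folklore] -/
def pairBoostLabel (k : ZMod L) : TorusSite 2 L :=
  Pi.single 0 (-(k + k))

/-- The **bond-twisted local pair** `P_x^{(k)} = Σ_{e ∈ {0,±e₁,±e₂}} (g e/√2) e(k e₁) d_{x,x+e}`
(`localPair g L x` with the bond `(x, x+e)` weighted by the extra phase `e(k e₁)`). [folklore] -/
def boostedLocalPair (k : ZMod L) (x : TorusSite 2 L) :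
    Matrix (Finset (Orb (FermionTorus 2 L))) (Finset (Orb (FermionTorus 2 L))) ℂ :=
  ∑ e ∈ insert (0 : Site 2) unitSteps, ((g e / Real.sqrt 2 : ℝ) : ℂ) •
    ((ZMod.stdAddChar (k * Torus.proj L e 0) : ℂ) •
      bondPairAnn (FermionTorus.ofTorusSite x) (FermionTorus.ofTorusSite (x + Torus.proj L e)))

/-- The norm constant `C_g = Σ_{e ∈ {0} ∪ unitSteps} 2|g e|/√2` of `norm_toLp_localPair_mulVec_le`
(`‖P_x ψ‖ ≤ C_g ‖ψ‖`). Scalapino, Phys. Rep. 250 (1995) 329, §2. [folklore] -/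
def pairNormConst : ℝ :=
  ∑ e ∈ insert (0 : Site 2) unitSteps, ‖((g e / Real.sqrt 2 : ℝ) : ℂ)‖ * 2

/-- The `e₁`-kinetic weight `K(ψ) = Σ_{x,σ} Re⟨ψ, c†_{x+e₁,σ} c_{x,σ} ψ⟩` of the Peierls identity.
Watanabe (2019) §2.2.1, eq. (15). [cite: Watanabe2019, §2.2.3 and §4.1] -/
def e1HopRe (ψ : Fock (Orb (FermionTorus 2 L))) : ℝ :=
  ∑ x : TorusSite 2 L, ∑ σ : Fin 2,
    (star ψ ⬝ᵥ ((creation (orb (FermionTorus.ofTorusSite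
        (Literature.MathematicalPhysics.QuantumFieldTheory.Site.shift x 0)) σ) *
      annihilation (orb (FermionTorus.ofTorusSite x) σ)) *ᵥ ψ)).re

/-- The `e₁`-current `J(ψ) = Σ_{x,σ} Im⟨ψ, c†_{x+e₁,σ} c_{x,σ} ψ⟩` of the Peierls identity.
Watanabe (2019) §2.2.1, eq. (16). [cite: Watanabe2019, §2.2.3 and §4.1] -/
def e1HopIm (ψ : Fock (Orb (FermionTorus 2 L))) : ℝ :=
  ∑ x : TorusSite 2 L, ∑ σ : Fin 2,
    (star ψ ⬝ᵥ ((creation (orb (FermionTorus.ofTorusSite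
        (Literature.MathematicalPhysics.QuantumFieldTheory.Site.shift x 0)) σ) *
      annihilation (orb (FermionTorus.ofTorusSite x) σ)) *ᵥ ψ)).im

end Defs

section Torus

variable (g : Site 2 → ℝ) {L : ℕ} [NeZero L]

/-- `C_g ≥ 0`. [folklore] -/
theorem pairNormConst_nonneg : 0 ≤ pairNormConst g :=
  Finset.sum_nonneg fun _ _ => by positivity

/-- The boost phase at a fermionic-torus site: `e(k y₁)` as a complex number. [folklore] -/
theorem coe_pairBoostPhase_ofTorusSite (k : ZMod L) (y : TorusSite 2 L) :
    ((pairBoostPhase L k (FermionTorus.ofTorusSite y).toTorusSite : Circle) : ℂ) =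
      ZMod.stdAddChar (k * y 0) := by
  rw [FermionTorus.toTorusSite_ofTorusSite]
  rfl

/-- `e(s)⁻¹ = exp(-2πi s/L)` on the unit circle. [folklore] -/
theorem toCircle_intCast_inv (s : ℤ) :
    (ZMod.toCircle ((s : ℤ) : ZMod L))⁻¹ = Circle.exp (-(2 * Real.pi * s) / L) := by
  refine Circle.coe_inj.1 ?_
  rw [Circle.coe_inv_eq_conj, ZMod.toCircle_intCast, Circle.coe_exp, ← Complex.exp_conj]
  congr 1
  simp only [map_div₀, map_mul, map_ofNat, Complex.conj_ofReal, Complex.conj_I, map_intCast,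
    map_natCast]
  push_cast
  ring

/-- **The boost is a pure gauge with uniform twist**: `(x,i) ↦ g_k(x) g_k(x+eᵢ)⁻¹ = uniformTwistConfig L θ`
whenever `exp(iθ/L) = e(k)⁻¹`. Watanabe (2019) §2.2.3. [cite: Watanabe2019, §2.2.3 and §4.1] -/
theorem gaugeTransform_pairBoostPhase {k : ZMod L} {θ : ℝ}
    (h : Circle.exp (θ / L) = (ZMod.toCircle k)⁻¹) :
    gaugeTransform (pairBoostPhase L k) 1 = uniformTwistConfig L θ := by
  funext ⟨x, i⟩
  rw [uniformTwistConfig_apply]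
  simp only [gaugeTransform, Pi.one_apply, mul_one, pairBoostPhase]
  fin_cases i
  · simp only [Fin.zero_eta, Fin.isValue, if_true]
    rw [shift_zero_apply_zero, mul_add, mul_one, AddChar.map_add_eq_mul, _root_.mul_inv_rev, ← mul_assoc,
      mul_inv_cancel_comm, h]
  · simp only [Fin.mk_one, Fin.isValue, one_ne_zero, if_false]
    rw [shift_one_apply_zero, mul_inv_cancel]

/-- **The boosted Hamiltonian is the uniformly twisted torus** (`L ≥ 3`, `s ∈ ℤ`): `W_sᴴ H(1,U) W_s = H_A`,
`A = uniformTwistConfig L (-2πs)`. Watanabe (2019) §2.2.3; Bohm (1949). [cite: Watanabe2019, §2.2.3 and §4.1] -/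
theorem pairBoost_intCast_conjTranspose_mul_hubbardTorus_mul (hL : 3 ≤ L) (U : ℝ) (s : ℤ) :
    (pairBoost L (s : ZMod L))ᴴ * hubbardTorus 2 L 1 U * pairBoost L (s : ZMod L) =
      magneticHubbardTorus L (uniformTwistConfig L (-(2 * Real.pi * s))) 1 U := by
  rw [← gaugeTransform_pairBoostPhase (k := (s : ZMod L)) (θ := -(2 * Real.pi * s))
      (by rw [toCircle_intCast_inv]), magneticHubbardTorus_gaugeTransform_one hL]
  rfl

/-- **Energy of a boosted state** (`L ≥ 3`, `s ∈ ℤ`, any `ψ`):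
`Re⟨W_s ψ, H W_s ψ⟩ = Re⟨ψ, H ψ⟩ + 2(1 - cos(-2πs/L)) K(ψ) + 2 sin(-2πs/L) J(ψ)`. Watanabe (2019)
§2.2.1, eqs. (13)–(16); Bohm (1949). [cite: Watanabe2019, §2.2.3 and §4.1] -/
theorem re_star_dotProduct_hubbardTorus_pairBoost_mulVec (hL : 3 ≤ L) (U : ℝ) (s : ℤ)
    (ψ : Fock (Orb (FermionTorus 2 L))) :
    (star (pairBoost L (s : ZMod L) *ᵥ ψ) ⬝ᵥ
        (hubbardTorus 2 L 1 U *ᵥ (pairBoost L (s : ZMod L) *ᵥ ψ))).re =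
      (star ψ ⬝ᵥ (hubbardTorus 2 L 1 U *ᵥ ψ)).re +
        2 * (1 - Real.cos (-(2 * Real.pi * s) / L)) * e1HopRe L ψ +
        2 * Real.sin (-(2 * Real.pi * s) / L) * e1HopIm L ψ := by
  rw [mulVec_mulVec, star_mulVec_dotProduct_mulVec, ← Matrix.mul_assoc,
    pairBoost_intCast_conjTranspose_mul_hubbardTorus_mul hL,
    re_star_dotProduct_magneticHubbardTorus_uniformTwistConfig_mulVec,
    magneticHubbardTorus_one_eq_hubbardTorus hL]
  rfl

/-- Boosts preserve every joint sector `(N, S^z)`. [cite: KomaTasakiPRL1992, eq. (5)] -/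
theorem pairBoost_mulVec_mem_szSector (k : ZMod L) {N : ℕ} {Sz : ℝ}
    {ψ : Fock (Orb (FermionTorus 2 L))} (h : ψ ∈ szSector N Sz) :
    pairBoost L k *ᵥ ψ ∈ szSector N Sz :=
  phaseGauge_mulVec_mem_szSector _ h

/-! ### The boosted pair field -/

/-- `localPair g L x = Σ_e (g e/√2) d_{x, x+e}` (definitional). [folklore] -/
theorem localPair_eq_sum_bondPairAnn (x : TorusSite 2 L) :
    localPair g L x = ∑ e ∈ insert (0 : Site 2) unitSteps, ((g e / Real.sqrt 2 : ℝ) : ℂ) •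
      bondPairAnn (FermionTorus.ofTorusSite x) (FermionTorus.ofTorusSite (x + Torus.proj L e)) :=
  rfl

/-- **Boost of one bond pair**: `W_kᴴ d_{x,x+e} W_k = e(2k x₁) e(k e₁) d_{x,x+e}`. Bohm (1949);
Watanabe (2019) §2.2.1. [folklore] -/
theorem pairBoost_conj_bondPairAnn (k : ZMod L) (x : TorusSite 2 L) (e : Site 2) :
    (pairBoost L k)ᴴ *
        bondPairAnn (FermionTorus.ofTorusSite x) (FermionTorus.ofTorusSite (x + Torus.proj L e)) *
        pairBoost L k =
      ((ZMod.stdAddChar ((k + k) * x 0) : ℂ) * ZMod.stdAddChar (k * Torus.proj L e 0)) •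
        bondPairAnn (FermionTorus.ofTorusSite x) (FermionTorus.ofTorusSite (x + Torus.proj L e)) := by
  rw [pairBoost, conjTranspose_phaseGauge_mul_bondPairAnn_mul_phaseGauge,
    coe_pairBoostPhase_ofTorusSite, coe_pairBoostPhase_ofTorusSite, Pi.add_apply, mul_add, add_mul,
    AddChar.map_add_eq_mul, AddChar.map_add_eq_mul]
  congr 1
  ring

/-- **Boost of the local pair**: `W_kᴴ P_x W_k = e(2k x₁) P_x^{(k)}`. [folklore] -/
theorem pairBoost_conj_localPair (k : ZMod L) (x : TorusSite 2 L) :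
    (pairBoost L k)ᴴ * localPair g L x * pairBoost L k =
      (ZMod.stdAddChar ((k + k) * x 0) : ℂ) • boostedLocalPair g L k x := by
  rw [localPair_eq_sum_bondPairAnn, boostedLocalPair, Finset.mul_sum, Finset.sum_mul, Finset.smul_sum]
  refine Finset.sum_congr rfl fun e _ => ?_
  rw [Matrix.mul_smul, Matrix.smul_mul, pairBoost_conj_bondPairAnn, ← smul_smul]
  exact smul_comm _ _ _

/-- The phase of the boosted pair field is the conjugate torus character of the label `m_k`:
`conj χ_{m_k}(x) = e(2k x₁)`. [folklore] -/
theorem conj_torusChar_pairBoostLabel (k : ZMod L) (x : TorusSite 2 L) :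
    conj (torusChar (pairBoostLabel L k) x) = ZMod.stdAddChar ((k + k) * x 0) := by
  rw [torusChar_eq_stdAddChar_sum, Fin.sum_univ_two, pairBoostLabel, Pi.single_eq_same,
    Pi.single_eq_of_ne (show (1 : Fin 2) ≠ 0 by decide), zero_mul, add_zero, neg_mul,
    ZMod.stdAddChar_apply, ZMod.stdAddChar_apply, AddChar.map_neg_eq_inv, Circle.coe_inv_eq_conj,
    Complex.conj_conj]

/-- **A boost shifts the pair momentum by `2k`**: `W_kᴴ Δ_g W_k = Σ_x conj χ_{m_k}(x) • P_x^{(k)}` (the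
momentum-`m_k` Fourier mode of the bond-twisted local pairs). Bohm (1949). [folklore] -/
theorem pairBoost_conj_pairField (k : ZMod L) :
    (pairBoost L k)ᴴ * pairField g L * pairBoost L k =
      ∑ x, conj (torusChar (pairBoostLabel L k) x) • boostedLocalPair g L k x := by
  rw [pairField, Finset.mul_sum, Finset.sum_mul]
  exact Finset.sum_congr rfl fun x _ => by rw [pairBoost_conj_localPair, conj_torusChar_pairBoostLabel]

/-- `W_kᴴ Δ_g W_k - Δ_g(m_k) = Σ_x conj χ_{m_k}(x) • (P_x^{(k)} - P_x)`. [folklore] -/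
theorem pairBoost_conj_pairField_sub_pairFieldAt (k : ZMod L) :
    (pairBoost L k)ᴴ * pairField g L * pairBoost L k - pairFieldAt g L (pairBoostLabel L k) =
      ∑ x, conj (torusChar (pairBoostLabel L k) x) • (boostedLocalPair g L k x - localPair g L x) := by
  rw [pairBoost_conj_pairField, pairFieldAt_eq_sum_torusChar, ← Finset.sum_sub_distrib]
  exact Finset.sum_congr rfl fun x _ => (smul_sub _ _ _).symm

/-! ### The deviation `P_x^{(k)} - P_x` is small for small `k` -/

/-- `P_x^{(k)} - P_x = Σ_e (g e/√2) (e(k e₁) - 1) d_{x,x+e}`. [folklore] -/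
theorem boostedLocalPair_sub_localPair (k : ZMod L) (x : TorusSite 2 L) :
    boostedLocalPair g L k x - localPair g L x =
      ∑ e ∈ insert (0 : Site 2) unitSteps, ((g e / Real.sqrt 2 : ℝ) : ℂ) •
        (((ZMod.stdAddChar (k * Torus.proj L e 0) : ℂ) - 1) •
          bondPairAnn (FermionTorus.ofTorusSite x) (FermionTorus.ofTorusSite (x + Torus.proj L e))) := by
  rw [boostedLocalPair, localPair_eq_sum_bondPairAnn, ← Finset.sum_sub_distrib]
  refine Finset.sum_congr rfl fun e _ => ?_
  rw [← smul_sub, sub_smul, one_smul]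

/-- If every bond phase is `η`-close to `1`, then `‖(P_x^{(k)} - P_x) ψ‖ ≤ η C_g ‖ψ‖`. [folklore] -/
theorem norm_toLp_boostedLocalPair_sub_localPair_mulVec_le {k : ZMod L} {η : ℝ} (hη0 : 0 ≤ η)
    (hη : ∀ e ∈ insert (0 : Site 2) unitSteps,
      ‖(ZMod.stdAddChar (k * Torus.proj L e 0) : ℂ) - 1‖ ≤ η)
    (x : TorusSite 2 L) (ψ : Fock (Orb (FermionTorus 2 L))) :
    ‖(WithLp.toLp 2 ((boostedLocalPair g L k x - localPair g L x) *ᵥ ψ) :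
        EuclideanSpace ℂ (Finset (Orb (FermionTorus 2 L))))‖ ≤
      η * pairNormConst g *
        ‖(WithLp.toLp 2 ψ : EuclideanSpace ℂ (Finset (Orb (FermionTorus 2 L))))‖ := by
  rw [boostedLocalPair_sub_localPair]
  simp only [Matrix.sum_mulVec, Matrix.smul_mulVec, WithLp.toLp_sum, WithLp.toLp_smul]
  rw [pairNormConst, Finset.mul_sum, Finset.sum_mul]
  refine norm_sum_le_of_le _ fun e he => ?_
  rw [norm_smul, norm_smul]
  calc _ ≤ ‖((g e / Real.sqrt 2 : ℝ) : ℂ)‖ *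
          (η * (2 * ‖(WithLp.toLp 2 ψ : EuclideanSpace ℂ (Finset (Orb (FermionTorus 2 L))))‖)) :=
        mul_le_mul_of_nonneg_left
          (mul_le_mul (hη e he) (norm_toLp_bondPairAnn_mulVec_le _ _ _) (norm_nonneg _) hη0)
          (norm_nonneg _)
    _ = _ := by ring

/-- **Chord–arc bound for the standard character**: `‖e(s) - 1‖ ≤ 2π|s|/L` (`s ∈ ℤ`). [folklore] -/
theorem norm_stdAddChar_intCast_sub_one_le (s : ℤ) :
    ‖(ZMod.stdAddChar ((s : ℤ) : ZMod L) : ℂ) - 1‖ ≤ 2 * Real.pi * |(s : ℝ)| / L := by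
  have h : (ZMod.stdAddChar ((s : ℤ) : ZMod L) : ℂ) =
      Complex.exp (Complex.I * ((2 * Real.pi * s / L : ℝ) : ℂ)) := by
    rw [ZMod.stdAddChar_coe]
    congr 1
    push_cast
    ring
  rw [h]
  refine Real.norm_exp_I_mul_ofReal_sub_one_le.trans (le_of_eq ?_)
  rw [Real.norm_eq_abs, abs_div, abs_mul, abs_of_pos Real.two_pi_pos, Nat.abs_cast]

/-- For an integer boost `k = s` every bond phase of `P_x^{(k)}` is `2π|s|/L`-close to `1`:
`‖e(s · e₁-coordinate of the step) - 1‖ ≤ 2π|s|/L`. [folklore] -/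
theorem norm_stdAddChar_boost_step_sub_one_le (s : ℤ) {e : Site 2}
    (he : e ∈ insert (0 : Site 2) unitSteps) :
    ‖(ZMod.stdAddChar (((s : ℤ) : ZMod L) * Torus.proj L e 0) : ℂ) - 1‖ ≤
      2 * Real.pi * |(s : ℝ)| / L := by
  have hcast : ((s : ℤ) : ZMod L) * Torus.proj L e 0 = ((s * e 0 : ℤ) : ZMod L) := by
    simp [Torus.proj, Int.cast_mul]
  rw [hcast]
  refine (norm_stdAddChar_intCast_sub_one_le (s * e 0)).trans ?_
  have he0 : e 0 = 0 ∨ e 0 = 1 ∨ e 0 = -1 := by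
    simp only [unitSteps, Finset.mem_insert, Finset.mem_singleton] at he
    rcases he with rfl | rfl | rfl | rfl | rfl <;> simp
  have habs : |((s * e 0 : ℤ) : ℝ)| ≤ |(s : ℝ)| := by
    rcases he0 with h | h | h <;> simp [h]
  have hL : (0 : ℝ) < L := Nat.cast_pos.2 (NeZero.pos L)
  exact div_le_div_of_nonneg_right (mul_le_mul_of_nonneg_left habs (by positivity)) hL.le

/-- **Deviation of the boosted pair field from a pure Fourier mode** (`s ∈ ℤ`, any `ψ`):
`‖(W_sᴴ Δ_g W_s - Δ_g(m_s)) ψ‖ ≤ 2π|s| · L · C_g ‖ψ‖` (`L²` sites, each bond phase `2π|s|/L`-close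
to `1`). Bohm (1949). [folklore] -/
theorem norm_toLp_pairBoost_conj_pairField_sub_pairFieldAt_mulVec_le (s : ℤ)
    (ψ : Fock (Orb (FermionTorus 2 L))) :
    ‖(WithLp.toLp 2
        ((((pairBoost L (s : ZMod L))ᴴ * pairField g L * pairBoost L (s : ZMod L)) -
            pairFieldAt g L (pairBoostLabel L (s : ZMod L))) *ᵥ ψ) :
        EuclideanSpace ℂ (Finset (Orb (FermionTorus 2 L))))‖ ≤
      2 * Real.pi * |(s : ℝ)| * L * pairNormConst g *
        ‖(WithLp.toLp 2 ψ : EuclideanSpace ℂ (Finset (Orb (FermionTorus 2 L))))‖ := by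
  rw [pairBoost_conj_pairField_sub_pairFieldAt]
  simp only [Matrix.sum_mulVec, Matrix.smul_mulVec, WithLp.toLp_sum, WithLp.toLp_smul]
  have hη0 : 0 ≤ 2 * Real.pi * |(s : ℝ)| / L := by positivity
  have hL0 : (L : ℝ) ≠ 0 := Nat.cast_ne_zero.2 (NeZero.ne L)
  have hcard : (Fintype.card (TorusSite 2 L) : ℝ) = (L : ℝ) ^ 2 := by
    rw [Fintype.card_fun, ZMod.card, Fintype.card_fin]; push_cast; ring
  calc ‖∑ x, conj (torusChar (pairBoostLabel L (s : ZMod L)) x) •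
          (WithLp.toLp 2 ((boostedLocalPair g L (s : ZMod L) x - localPair g L x) *ᵥ ψ) :
            EuclideanSpace ℂ (Finset (Orb (FermionTorus 2 L))))‖
      ≤ ∑ x : TorusSite 2 L, 2 * Real.pi * |(s : ℝ)| / L * pairNormConst g *
          ‖(WithLp.toLp 2 ψ : EuclideanSpace ℂ (Finset (Orb (FermionTorus 2 L))))‖ :=
        norm_sum_le_of_le _ fun x _ => by
          rw [norm_smul, Complex.norm_conj, norm_torusChar, one_mul]
          exact norm_toLp_boostedLocalPair_sub_localPair_mulVec_le g hη0
            (fun e he => norm_stdAddChar_boost_step_sub_one_le s he) x ψ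
    _ = 2 * Real.pi * |(s : ℝ)| * L * pairNormConst g *
          ‖(WithLp.toLp 2 ψ : EuclideanSpace ℂ (Finset (Orb (FermionTorus 2 L))))‖ := by
        rw [Finset.sum_const, Finset.card_univ, nsmul_eq_mul, hcard]
        field_simp

end Torus

end Literature.MathematicalPhysics.QuantumLattice
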